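import Summits.NavierStokesRegularity.TurbBounds.ShearModeAssembly
import Summits.NavierStokesRegularity.TurbBounds.ShearPSDForm
import Summits.NavierStokesRegularity.TurbBounds.Certs.S50.EvalBlock2
import Summits.NavierStokesRegularity.TurbBounds.Certs.S50.SpecPieces2
import Summits.NavierStokesRegularity.TurbBounds.Certs.S50.TailSlack
import HarnessLib

/-!
# Row S50, mode 2: the certified block as an inequality on coefficient sequences (end-to-end composition, kernel)

Cell `turb-bounds` (pub-turb), shear lane, pub-turb-shear gen 6 (2026-08-22); v2 lane. Container `T7-fw16-Gx2-Gr50-P4-N12-j111081` (rbcert.json sha256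
9bdcefff37d2376c…), family fw16_shear_2d, mode `m = 2`: `N = 12`, `P = 4`, `dim = 2(N+P+3) = 38`. COMPOSITION of the whole algebraic chain for this mode:
* `Certs.S50.Eval.M2.rule_posSemidef` (landed evaluator) + `ShearPSDForm.pieces_form_nonneg` ⇒ piece form `≥ 0` at `ω = omegaOf (N+P+4) c₁ c₂`;
* `Certs.S50.SpecPieces.M2.*_spec` (generator C: the literal pieces ARE `q0Piece / qtPiece / qphiPiece` of rbsdp SPEC §2) ⇒ `pieces_nonneg`;
* `Certs.S50.kappaSlack_rule_nonneg` (landed `TailSlack`) + `ShearTailSeq.T2_coeff_nonneg_of_kappaSlack` ⇒ `slack` (the `T2` coefficient `A_m − κ̃_m T ≥ 0`);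
* `ShearModeAssembly.mode_assembly` ⇒ `mode_ineq`, and with `slack` ⇒ `modeForm_nonneg`: for the two ladders `c_i → a_i → b_i` (the Legendre coefficients of
  `W_i'', W_i', W_i` of the mode's two components, wall relations `c_i(0) = c_i(1)/3`) and any cross-term remainder `X_t` within the Young bound,
  `(c₁ᵀQ1c₁ + c₂ᵀQ1c₂) + A·T2 + 8·T1 + C·T0 − D·(Σ_p φ̂_p (c₁ᵀE_p c₂ − c₂ᵀE_p c₁) + X_t) ≥ 0`.
NOT in this file: the dictionary to `A‖W''‖² + 8‖W'‖² + C‖W‖² − D∫φ'(W₂'W₁ − W₁'W₂)` (`ShearBridgeNorms.norms_split` + the cross-term split, v2 items V2-TAIL/V2-BRIDGE)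
and the SPEC 2.1 reduction. Generator lean-t12/specpieces/gen_modeform_fw.py. HONEST FRAMING: rigorous bounds for the stated PDE and boundary conditions; no claim
about physical turbulence beyond the bound.
-/

set_option linter.style.longLine false

namespace Summit.NavierStokesRegularity.TurbBounds.Certs.S50.ModeForm.M2

open Finset Summit.NavierStokesRegularity.TurbBounds.LadderTail Summit.NavierStokesRegularity.TurbBounds.ShearTailSeq
  Summit.NavierStokesRegularity.TurbBounds.ShearSpecPieces Summit.NavierStokesRegularity.TurbBounds.Certs.S50

/-- The profile coefficients `φ̂_p` of the row (cast). -/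
def phi (p : ℕ) : ℝ := ((Scalars.phi[p]! : ℚ) : ℝ)

/-- **Piece positivity at `ω = omegaOf (N+P+4) c₁ c₂`** (landed evaluator `EvalBlock2` + generator-C identities `SpecPieces2`). -/
theorem pieces_nonneg (c₁ c₂ : ℕ → ℝ) :
    0 ≤ qform (q0Piece 12 4 (Am Scalars.Gx SpecPieces.M2.piHi 2) (Cm Scalars.Gx Scalars.piLo 2)) (2 * (12 + 4 + 4 - 1)) (omegaOf (12 + 4 + 4) c₁ c₂)
        + ∑ p ∈ range (4 + 1), phi p * qform (qphiPiece 12 4 (Dm Scalars.Gx Scalars.piLo 2) p) (2 * (12 + 4 + 4 - 1)) (omegaOf (12 + 4 + 4) c₁ c₂)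
        + (Scalars.T : ℝ) * qform (qtPiece 12 4 (Dm Scalars.Gx Scalars.piLo 2)) (2 * (12 + 4 + 4 - 1)) (omegaOf (12 + 4 + 4) c₁ c₂) := by
  have h0 := pieces_form_nonneg Eval.M2.rule_posSemidef (fun i : Fin 38 => omegaOf (12 + 4 + 4) c₁ c₂ (i : ℕ))
  have hext : ∀ M : List (List ℚ), qform M 38 (extFin (fun i : Fin 38 => omegaOf (12 + 4 + 4) c₁ c₂ (i : ℕ))) = qform M 38 (omegaOf (12 + 4 + 4) c₁ c₂) :=
    fun M => qform_congr M 38 fun i hi => by simp [extFin, hi]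
  simp only [Eval.M2.pieces1, List.map_cons, List.map_nil, List.sum_cons, List.sum_nil, hext, Rat.cast_one, one_mul] at h0
  have hQ0 := SpecPieces.M2.Q0_2_spec
  have hQT := SpecPieces.M2.QT_2_spec
  have hQphi0 := SpecPieces.M2.Qphi0_2_spec
  have hQphi1 := SpecPieces.M2.Qphi1_2_spec
  have hQphi2 := SpecPieces.M2.Qphi2_2_spec
  have hQphi3 := SpecPieces.M2.Qphi3_2_spec
  have hQphi4 := SpecPieces.M2.Qphi4_2_spec
  unfold SpecPieces.M2.N SpecPieces.M2.P at hQ0 hQT hQphi0 hQphi1 hQphi2 hQphi3 hQphi4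
  rw [hQ0, hQT, hQphi0, hQphi1, hQphi2, hQphi3, hQphi4] at h0
  rw [show (2 * (12 + 4 + 4 - 1)) = 38 by norm_num]
  convert h0 using 1
  simp only [Finset.sum_range_succ, Finset.sum_range_zero, phi]
  ring

/-- **The `T2` coefficient is nonnegative** (`A_2 − κ̃_2·T ≥ 0`, from the landed `TailSlack` via `T2_coeff_nonneg_of_kappaSlack`). -/
theorem slack : 0 ≤ (((Am Scalars.Gx SpecPieces.M2.piHi 2) : ℝ) - ((Dm Scalars.Gx Scalars.piLo 2) : ℝ) * ((delta 12 : ℝ) / 2 * lam0 12 4 + lam1 12 4 / (2 * (delta 12 : ℝ))) * (Scalars.T : ℝ)) := by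
  have hmem : ShearTailRule.kappaSlack Scalars.Gx (5419351 / 1725033) Scalars.piLo Scalars.T (Scalars.Nm.getD 1 0) 4 (1 + 1)
      ∈ ShearTailRule.kappaSlackList Scalars.Gx (5419351 / 1725033) Scalars.piLo Scalars.T 4 Scalars.Nm := by
    unfold ShearTailRule.kappaSlackList
    exact List.mem_map.mpr ⟨1, List.mem_range.mpr (by simp [Scalars.Nm]), rfl⟩
  have h := kappaSlack_rule_nonneg _ hmem
  have eN : Scalars.Nm.getD 1 0 = 12 := by simp [Scalars.Nm]
  rw [eN] at h
  have h2 := T2_coeff_nonneg_of_kappaSlack h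
  have eA : (Am Scalars.Gx SpecPieces.M2.piHi 2) = ShearTailRule.Am Scalars.Gx (5419351 / 1725033) (1 + 1) := by
    unfold Am ShearTailRule.Am SpecPieces.M2.piHi; norm_num
  have eD : (Dm Scalars.Gx Scalars.piLo 2) = ShearTailRule.Dm Scalars.Gx Scalars.piLo (1 + 1) := by
    unfold Dm ShearTailRule.Dm; norm_num
  have eδ : delta 12 = ShearTailRule.delta 12 := rfl
  rw [eA, eD, eδ]
  exact h2

/-- **Mode 2 of S50: the assembled inequality** (`mode_assembly` fed with `pieces_nonneg`). -/
theorem mode_ineq {c₁ a₁ b₁ c₂ a₂ b₂ : ℕ → ℝ}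
    (hA₁ : IsLadder c₁ a₁) (h0a₁ : a₁ 0 = c₁ 0 - c₁ 1 / 3) (hB₁ : IsLadder a₁ b₁) (hw₁ : c₁ 0 = c₁ 1 / 3)
    (hA₂ : IsLadder c₂ a₂) (h0a₂ : a₂ 0 = c₂ 0 - c₂ 1 / 3) (hB₂ : IsLadder a₂ b₂) (hw₂ : c₂ 0 = c₂ 1 / 3)
    (L : ℕ) {Xt : ℝ}
    (hX : |Xt| ≤ (Scalars.T : ℝ) * ((delta 12 : ℝ) / 2 * (∑ k ∈ range L, w (12 + 1 + k) * b₁ (12 + 1 + k) ^ 2 + ∑ k ∈ range L, w (12 + 1 + k) * b₂ (12 + 1 + k) ^ 2)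
          + (∑ k ∈ range L, w (12 + 2 + k) * a₁ (12 + 2 + k) ^ 2 + ∑ k ∈ range L, w (12 + 2 + k) * a₂ (12 + 2 + k) ^ 2) / (2 * (delta 12 : ℝ)))) :
    (((Am Scalars.Gx SpecPieces.M2.piHi 2) : ℝ) - ((Dm Scalars.Gx Scalars.piLo 2) : ℝ) * ((delta 12 : ℝ) / 2 * lam0 12 4 + lam1 12 4 / (2 * (delta 12 : ℝ))) * (Scalars.T : ℝ))
        * (∑ k ∈ range L, w (12 + 4 + 4 + k) * c₁ (12 + 4 + 4 + k) ^ 2 + ∑ k ∈ range L, w (12 + 4 + 4 + k) * c₂ (12 + 4 + 4 + k) ^ 2)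
      ≤ (qform (q1Tab 12 4 (Am Scalars.Gx SpecPieces.M2.piHi 2) (Cm Scalars.Gx Scalars.piLo 2)) (12 + 4 + 4) c₁ + qform (q1Tab 12 4 (Am Scalars.Gx SpecPieces.M2.piHi 2) (Cm Scalars.Gx Scalars.piLo 2)) (12 + 4 + 4) c₂)
        + (((Am Scalars.Gx SpecPieces.M2.piHi 2) : ℝ) * (∑ k ∈ range L, w (12 + 4 + 4 + k) * c₁ (12 + 4 + 4 + k) ^ 2 + ∑ k ∈ range L, w (12 + 4 + 4 + k) * c₂ (12 + 4 + 4 + k) ^ 2)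
           + 8 * (∑ k ∈ range L, w (12 + 2 + k) * a₁ (12 + 2 + k) ^ 2 + ∑ k ∈ range L, w (12 + 2 + k) * a₂ (12 + 2 + k) ^ 2)
           + ((Cm Scalars.Gx Scalars.piLo 2) : ℝ) * (∑ k ∈ range L, w (12 + 1 + k) * b₁ (12 + 1 + k) ^ 2 + ∑ k ∈ range L, w (12 + 1 + k) * b₂ (12 + 1 + k) ^ 2))
        - ((Dm Scalars.Gx Scalars.piLo 2) : ℝ) * ((∑ p ∈ range (4 + 1), phi p * (bform (eTab 12 4 p) (12 + 4 + 4) c₁ c₂ - bform (eTab 12 4 p) (12 + 4 + 4) c₂ c₁)) + Xt) := by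
  have hC : 0 ≤ (((Cm Scalars.Gx Scalars.piLo 2) : ℚ) : ℝ) := by unfold Cm; positivity
  have hD : 0 ≤ (((Dm Scalars.Gx Scalars.piLo 2) : ℚ) : ℝ) := by
    have : 0 < (Dm Scalars.Gx Scalars.piLo 2) := by unfold Dm; norm_num [Scalars.Gx, Scalars.piLo]
    exact_mod_cast this.le
  have hT : 0 ≤ (Scalars.T : ℝ) := by norm_num [Scalars.T]
  exact mode_assembly 12 4 (Am Scalars.Gx SpecPieces.M2.piHi 2) (Cm Scalars.Gx Scalars.piLo 2) (Dm Scalars.Gx Scalars.piLo 2) (Scalars.T : ℝ) phi hA₁ h0a₁ hB₁ hw₁ hA₂ h0a₂ hB₂ hw₂ L hC hD hT hX (pieces_nonneg c₁ c₂)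

/-- **Mode 2 of S50 as an inequality on coefficient sequences**: tracked forms + all Parseval tails − D·(coupling + remainder) `≥ 0`
(everything kernel-checked: evaluator, generator-C identities, κ-slack, tail lemma, assembly). -/
theorem modeForm_nonneg {c₁ a₁ b₁ c₂ a₂ b₂ : ℕ → ℝ}
    (hA₁ : IsLadder c₁ a₁) (h0a₁ : a₁ 0 = c₁ 0 - c₁ 1 / 3) (hB₁ : IsLadder a₁ b₁) (hw₁ : c₁ 0 = c₁ 1 / 3)
    (hA₂ : IsLadder c₂ a₂) (h0a₂ : a₂ 0 = c₂ 0 - c₂ 1 / 3) (hB₂ : IsLadder a₂ b₂) (hw₂ : c₂ 0 = c₂ 1 / 3)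
    (L : ℕ) {Xt : ℝ}
    (hX : |Xt| ≤ (Scalars.T : ℝ) * ((delta 12 : ℝ) / 2 * (∑ k ∈ range L, w (12 + 1 + k) * b₁ (12 + 1 + k) ^ 2 + ∑ k ∈ range L, w (12 + 1 + k) * b₂ (12 + 1 + k) ^ 2)
          + (∑ k ∈ range L, w (12 + 2 + k) * a₁ (12 + 2 + k) ^ 2 + ∑ k ∈ range L, w (12 + 2 + k) * a₂ (12 + 2 + k) ^ 2) / (2 * (delta 12 : ℝ)))) :
    0 ≤ (qform (q1Tab 12 4 (Am Scalars.Gx SpecPieces.M2.piHi 2) (Cm Scalars.Gx Scalars.piLo 2)) (12 + 4 + 4) c₁ + qform (q1Tab 12 4 (Am Scalars.Gx SpecPieces.M2.piHi 2) (Cm Scalars.Gx Scalars.piLo 2)) (12 + 4 + 4) c₂)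
        + (((Am Scalars.Gx SpecPieces.M2.piHi 2) : ℝ) * (∑ k ∈ range L, w (12 + 4 + 4 + k) * c₁ (12 + 4 + 4 + k) ^ 2 + ∑ k ∈ range L, w (12 + 4 + 4 + k) * c₂ (12 + 4 + 4 + k) ^ 2)
           + 8 * (∑ k ∈ range L, w (12 + 2 + k) * a₁ (12 + 2 + k) ^ 2 + ∑ k ∈ range L, w (12 + 2 + k) * a₂ (12 + 2 + k) ^ 2)
           + ((Cm Scalars.Gx Scalars.piLo 2) : ℝ) * (∑ k ∈ range L, w (12 + 1 + k) * b₁ (12 + 1 + k) ^ 2 + ∑ k ∈ range L, w (12 + 1 + k) * b₂ (12 + 1 + k) ^ 2))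
        - ((Dm Scalars.Gx Scalars.piLo 2) : ℝ) * ((∑ p ∈ range (4 + 1), phi p * (bform (eTab 12 4 p) (12 + 4 + 4) c₁ c₂ - bform (eTab 12 4 p) (12 + 4 + 4) c₂ c₁)) + Xt) := by
  have h := mode_ineq hA₁ h0a₁ hB₁ hw₁ hA₂ h0a₂ hB₂ hw₂ L hX
  have hT2 : 0 ≤ (∑ k ∈ range L, w (12 + 4 + 4 + k) * c₁ (12 + 4 + 4 + k) ^ 2 + ∑ k ∈ range L, w (12 + 4 + 4 + k) * c₂ (12 + 4 + 4 + k) ^ 2) :=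
    add_nonneg (Finset.sum_nonneg fun k _ => mul_nonneg (w_pos _).le (sq_nonneg _)) (Finset.sum_nonneg fun k _ => mul_nonneg (w_pos _).le (sq_nonneg _))
  have hs := mul_nonneg slack hT2
  linarith

end Summit.NavierStokesRegularity.TurbBounds.Certs.S50.ModeForm.M2
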